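import Summits.Ventures.WeilGRH.UniformConductorFloor
import Summits.Ventures.WeilGRH.TwoPrimeReflectionCriterion
import Literature.NumberTheory.LFunctions.WeilFinitePrimeSliver
import Literature.Analysis.SpecialFunctions.DigammaVerticalSeries
import Literature.Analysis.SpecialFunctions.DigammaReflection
import HarnessLib

/-!
# GRH arm (rh-explicit, venture WeilGRH): numerical uniform conductor floors (all characters, no `ζ` input)

Cell `rh-explicit`, WEIL TRACK — GRH ARM (weil-grh-1).  Instances of the budget theorem
`UniformFloor.weilPositivityOnChar_of_budget` (`UniformConductorFloor.lean`):
`log π − ψ(¼ + κ/2) − Σ_{m<M}(1/(m + ¼ + κ/2) − 2t) + 2Σ_{n≤N}(Λ(n)/√n)c_n ≤ log q ⇒ WeilPositivityOnChar χ t`,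
with the tree's decimal bounds `ψ(¼) ≥ −4.22745354`, `ψ(¾) = ψ(¼) + π`, `log π ≤ 1.1447299`,
`log 2/√2 ≤ 0.49014`, `log 3/√3 ≤ 0.6343`, `log 5/√5 ≤ 0.7197626`, `log 7/√7 ≤ 0.7354854`.

| window `t` | prime powers | parity | `M` | budget `≤` | method floor | PROVED floor |
|---|---|---|---|---|---|---|
| `1` | `2; 3, 4, 5, 7` halved | even (hence all) | `1` | `6.7886` | `888` | **`q ≥ 900`** |
| `1` | same | odd | `0` | `5.6470` | `284` | **`q ≥ 288`** |
| `4023/5000` (`ζ` frontier) | `2; 3, 4` halved | even (hence all) | `1` | `4.9424` | `141` | **`q ≥ 144`** |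
| `4023/5000` | same | odd | `0` | `4.1918` | `67` | **`q ≥ 72`** |
| `log 2` | `2, 3` halved | odd | `0` | `3.3551` | `29` | **`q ≥ 30`** |

So **Weil positivity on `[-1, 1]` holds for EVERY Dirichlet character of EVERY modulus `q ≥ 900`**
(`weilPositivityOnChar_one_of_ge_900`; odd characters: `q ≥ 288`), unconditionally and uniformly in the
values of `χ`; at the `ζ` frontier `4023/5000` the uniform floor drops from the tree's `q ≥ 450`
(`FrontierTransfer.lean`, via the `ζ` rung) to `q ≥ 144` (odd: `72`).  These are NOT the sharp floors
(cell data: `78` even / `30` odd at `t = 1`); closing `100 < q < 900` uniformly is a certificate task.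

## References

* A. Weil (1952), (11) and the «lemme» p. 262 [Weil1952FormulesExplicites]; H. Yoshida (1992) §2, §6 [Yoshida1992].
-/

noncomputable section

open Complex Filter Set MeasureTheory
open scoped Real Topology ComplexConjugate ArithmeticFunction.vonMangoldt

namespace Summit.Ventures.WeilGRH

open Literature.NumberTheory.LFunctions

namespace UniformFloor

variable {q : ℕ}

/-! ## The constants -/

/-- `ψ(¼ + 0/2) ≥ −4.22745354` in the shape of the budget theorem. [folklore] -/
theorem psi_even_ge : (-4.22745354 : ℝ) ≤ (digamma (((1 / 4 + ((0 : ℕ) : ℝ) / 2 : ℝ)) : ℂ)).re := by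
  have e : (((1 / 4 + ((0 : ℕ) : ℝ) / 2 : ℝ)) : ℂ) = (1 / 4 : ℂ) := by push_cast; norm_num
  rw [e]
  exact Literature.Analysis.SpecialFunctions.re_digamma_one_quarter_ge

/-- `ψ(¼ + 1/2) = ψ(¾) = ψ(¼) + π ≥ −1.08586154`. [folklore] -/
theorem psi_odd_ge : (-1.08586154 : ℝ) ≤ (digamma (((1 / 4 + ((1 : ℕ) : ℝ) / 2 : ℝ)) : ℂ)).re := by
  have h1 := Literature.Analysis.SpecialFunctions.re_digamma_one_quarter_ge
  have hre := congrArg Complex.re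
    Literature.Analysis.SpecialFunctions.Complex.digamma_three_quarters_sub_digamma_one_quarter
  rw [Complex.sub_re, Complex.ofReal_re] at hre
  have e : (((1 / 4 + ((1 : ℕ) : ℝ) / 2 : ℝ)) : ℂ) = (3 / 4 : ℂ) := by push_cast; norm_num
  rw [e]
  have hπ := Real.pi_gt_d6
  linarith

/-! The weights are written as literal lambdas (no definitions in this proof file):
`cLow = fun n ↦ if n ≤ 2 then 1 else 1/2` (windows `t ≤ log 3`) and
`cLogTwo = fun n ↦ if n ≤ 1 then 1 else 1/2` (window `t = log 2`). -/

/-- `cLow` is admissible on every window `t ≤ 1`: `c_n ≥ 1` for `n ≤ 2`, else `c_n = ½` and `t ≤ 1 < log 3 ≤ log n`.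
[folklore] -/
theorem cLow_admissible {t : ℝ} (ht : t ≤ 1) (N : ℕ) :
    ∀ n ∈ Finset.range (N + 1), 1 ≤ (fun n : ℕ ↦ if n ≤ 2 then (1 : ℝ) else 1 / 2) n ∨ (1 / 2 ≤ (fun n : ℕ ↦ if n ≤ 2 then (1 : ℝ) else 1 / 2) n ∧ t ≤ Real.log n) := by
  intro n _
  by_cases h : n ≤ 2
  · left; simp [h]
  · right
    refine ⟨by simp [h], ?_⟩
    have h3 : (3 : ℝ) ≤ n := by exact_mod_cast (show 3 ≤ n by omega)
    have hl : Real.log 3 ≤ Real.log n := Real.log_le_log (by norm_num) h3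
    linarith [Real.log_three_gt_d9]

/-- `cLogTwo` is admissible on the window `t = log 2`. [folklore] -/
theorem cLogTwo_admissible (N : ℕ) :
    ∀ n ∈ Finset.range (N + 1), 1 ≤ (fun n : ℕ ↦ if n ≤ 1 then (1 : ℝ) else 1 / 2) n ∨ (1 / 2 ≤ (fun n : ℕ ↦ if n ≤ 1 then (1 : ℝ) else 1 / 2) n ∧ Real.log 2 ≤ Real.log n) := by
  intro n _
  by_cases h : n ≤ 1
  · left; simp [h]
  · right
    refine ⟨by simp [h], ?_⟩
    have h2 : (2 : ℝ) ≤ n := by exact_mod_cast (show 2 ≤ n by omega)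
    exact Real.log_le_log (by norm_num) h2

/-- `Λ(2) = log 2`, `Λ(3) = log 3`. [folklore] -/
theorem vonMangoldt_two_three :
    (Λ 2 : ℝ) = Real.log 2 ∧ (Λ 3 : ℝ) = Real.log 3 := by
  constructor
  · rw [ArithmeticFunction.vonMangoldt_apply_prime Nat.prime_two]; norm_num
  · rw [ArithmeticFunction.vonMangoldt_apply_prime Nat.prime_three]; norm_num

/-- **The five-prime-power weight sum at `t ≤ 1`**:
`Σ_{n<8} (Λ(n)/√n) c_n = log 2/√2 + ½(log 3/√3 + log 2/2 + log 5/√5 + log 7/√7) ≤ 1.7082008`. [folklore] -/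
theorem sum_range_eight_cLow_le :
    ∑ n ∈ Finset.range 8, (Λ n : ℝ) / Real.sqrt n * (fun n : ℕ ↦ if n ≤ 2 then (1 : ℝ) else 1 / 2) n ≤ 1.7082008 := by
  obtain ⟨h2, h3⟩ := vonMangoldt_two_three
  have hk2 := kprime_bounds.2
  have hk3 := kthree_le
  have hk5 := log_five_div_sqrt_five_le
  have hk7 := log_seven_div_sqrt_seven_le
  have hl2 := Real.log_two_lt_d9
  simp only [Finset.sum_range_succ, Finset.sum_range_zero, ArithmeticFunction.map_zero,
    ArithmeticFunction.vonMangoldt_apply_one, h2, h3, vonMangoldt_four, vonMangoldt_five, vonMangoldt_six,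
    vonMangoldt_seven, sqrt_four_eq_two]
  norm_num
  linarith

/-- **The three-prime-power weight sum at `t ≤ 1`**: `Σ_{n<5} (Λ(n)/√n) c_n = log 2/√2 + ½(log 3/√3 + log 2/2) ≤ 0.9805768`.
[folklore] -/
theorem sum_range_five_cLow_le :
    ∑ n ∈ Finset.range 5, (Λ n : ℝ) / Real.sqrt n * (fun n : ℕ ↦ if n ≤ 2 then (1 : ℝ) else 1 / 2) n ≤ 0.9805768 := by
  obtain ⟨h2, h3⟩ := vonMangoldt_two_three
  have hk2 := kprime_bounds.2
  have hk3 := kthree_le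
  have hl2 := Real.log_two_lt_d9
  simp only [Finset.sum_range_succ, Finset.sum_range_zero, ArithmeticFunction.map_zero,
    ArithmeticFunction.vonMangoldt_apply_one, h2, h3, vonMangoldt_four, sqrt_four_eq_two]
  norm_num
  linarith

/-- **The two-prime weight sum at `t = log 2`**: `Σ_{n<4} (Λ(n)/√n) c_n = ½(log 2/√2 + log 3/√3) ≤ 0.56222`. [folklore] -/
theorem sum_range_four_cLogTwo_le :
    ∑ n ∈ Finset.range 4, (Λ n : ℝ) / Real.sqrt n * (fun n : ℕ ↦ if n ≤ 1 then (1 : ℝ) else 1 / 2) n ≤ 0.56222 := by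
  obtain ⟨h2, h3⟩ := vonMangoldt_two_three
  have hk2 := kprime_bounds.2
  have hk3 := kthree_le
  simp only [Finset.sum_range_succ, Finset.sum_range_zero, ArithmeticFunction.map_zero,
    ArithmeticFunction.vonMangoldt_apply_one, h2, h3]
  norm_num
  linarith

/-- `e² ≤ 8`. [folklore] -/
theorem exp_two_le_eight : Real.exp (2 * 1) ≤ (((7 : ℕ) : ℝ)) + 1 := by
  have h := Real.exp_one_lt_d9
  have h0 := Real.exp_pos 1
  have e : Real.exp (2 * 1) = Real.exp 1 ^ 2 := by
    rw [← Real.exp_nat_mul]; norm_num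
  rw [e]
  push_cast
  nlinarith

/-- `e^{2·4023/5000} ≤ 5` (`8046/5000 = 1.6092 < log 5`). [folklore] -/
theorem exp_frontier_le_five : Real.exp (2 * (4023 / 5000)) ≤ (((4 : ℕ) : ℝ)) + 1 := by
  have h5 := Real.log_five_gt_d9
  have e : (((4 : ℕ) : ℝ)) + 1 = 5 := by norm_num
  rw [e, ← Real.le_log_iff_exp_le (by norm_num)]
  linarith

/-- `e^{2 log 2} = 4`. [folklore] -/
theorem exp_two_log_two_le_four : Real.exp (2 * Real.log 2) ≤ (((3 : ℕ) : ℝ)) + 1 := by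
  rw [show (2 : ℝ) * Real.log 2 = Real.log 4 by
    rw [show (4 : ℝ) = 2 ^ 2 by norm_num, Real.log_pow]; push_cast; ring,
    Real.exp_log (by norm_num)]
  norm_num

/-- Lower bounds for the logarithms of the floors: `log 900 ≥ 6.8023947`, `log 288 ≥ 5.6629604`,
`log 144 ≥ 4.9698132`, `log 72 ≥ 4.276666`, `log 30 ≥ 3.4011973`. [folklore] -/
theorem log_floor_bounds :
    (6.8023947 : ℝ) ≤ Real.log 900 ∧ (5.6629604 : ℝ) ≤ Real.log 288 ∧ (4.9698132 : ℝ) ≤ Real.log 144 ∧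
      (4.276666 : ℝ) ≤ Real.log 72 ∧ (3.4011973 : ℝ) ≤ Real.log 30 := by
  have h2 := Real.log_two_gt_d9
  have h3 := Real.log_three_gt_d9
  have h5 := Real.log_five_gt_d9
  have e900 : Real.log 900 = 2 * Real.log 2 + 2 * Real.log 3 + 2 * Real.log 5 := by
    rw [show (900 : ℝ) = (2 ^ 2 * 3 ^ 2) * 5 ^ 2 by norm_num, Real.log_mul (by norm_num) (by norm_num),
      Real.log_mul (by norm_num) (by norm_num), Real.log_pow, Real.log_pow, Real.log_pow]
    push_cast; ring
  have e288 : Real.log 288 = 5 * Real.log 2 + 2 * Real.log 3 := by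
    rw [show (288 : ℝ) = 2 ^ 5 * 3 ^ 2 by norm_num, Real.log_mul (by norm_num) (by norm_num),
      Real.log_pow, Real.log_pow]
    push_cast; ring
  have e144 : Real.log 144 = 4 * Real.log 2 + 2 * Real.log 3 := by
    rw [show (144 : ℝ) = 2 ^ 4 * 3 ^ 2 by norm_num, Real.log_mul (by norm_num) (by norm_num),
      Real.log_pow, Real.log_pow]
    push_cast; ring
  have e72 : Real.log 72 = 3 * Real.log 2 + 2 * Real.log 3 := by
    rw [show (72 : ℝ) = 2 ^ 3 * 3 ^ 2 by norm_num, Real.log_mul (by norm_num) (by norm_num),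
      Real.log_pow, Real.log_pow]
    push_cast; ring
  have e30 : Real.log 30 = Real.log 2 + Real.log 3 + Real.log 5 := by
    rw [show (30 : ℝ) = 2 * 3 * 5 by norm_num, Real.log_mul (by norm_num) (by norm_num),
      Real.log_mul (by norm_num) (by norm_num)]
  refine ⟨?_, ?_, ?_, ?_, ?_⟩
  · rw [e900]; linarith
  · rw [e288]; linarith
  · rw [e144]; linarith
  · rw [e72]; linarith
  · rw [e30]; linarith

/-- `log Q ≤ log q` for `Q ≤ q`, `0 < Q`. [folklore] -/
theorem log_le_log_natCast {Q : ℕ} (hQ : 0 < Q) (hq : Q ≤ q) : Real.log Q ≤ Real.log q :=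
  Real.log_le_log (by exact_mod_cast hQ) (by exact_mod_cast hq)

/-! ## The window `t = 1` -/

/-- **Every EVEN Dirichlet character of modulus `q ≥ 900` satisfies Weil positivity on `[-1, 1]`**
(budget `1.1447299 + 4.22745354 − 2 + 2·1.7082008 = 6.7885903 ≤ 6.8023947 ≤ log 900`; the method's
floor is `888`). [cite: Weil1952FormulesExplicites, (11) and the «lemme» p. 262; Yoshida1992, §6] -/
theorem weilPositivityOnChar_one_of_even_ge_900 (hq : 900 ≤ q) (χ : DirichletCharacter ℂ q)
    (hχ : χ.Even) : WeilPositivityOnChar χ 1 := by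
  have hq1 : q ≠ 1 := by omega
  have hS := sum_range_eight_cLow_le
  have hlog := log_floor_bounds.1.trans (log_le_log_natCast (by norm_num) hq)
  have hπ := Literature.Analysis.SpecialFunctions.Real.log_pi_le
  refine weilPositivityOnChar_of_budget hq1 χ (charParity_of_even hχ) one_pos exp_two_le_eight 1
    psi_even_ge (fun n : ℕ ↦ if n ≤ 2 then (1 : ℝ) else 1 / 2) (cLow_admissible le_rfl 7) ?_
  set S := ∑ n ∈ Finset.range (7 + 1),
    (Λ n : ℝ) / Real.sqrt n * (fun n : ℕ ↦ if n ≤ 2 then (1 : ℝ) else 1 / 2) n with hSdef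
  simp only [Finset.sum_range_one, Nat.cast_zero]
  norm_num
  linarith

/-- **Every ODD Dirichlet character of modulus `q ≥ 288` satisfies Weil positivity on `[-1, 1]`**
(budget `1.1447299 + 1.08586154 + 2·1.7082008 = 5.6469930 ≤ 5.6629604 ≤ log 288`; method floor `284`).
[cite: Weil1952FormulesExplicites, (11) and the «lemme» p. 262; Yoshida1992, §6] -/
theorem weilPositivityOnChar_one_of_odd_ge_288 [NeZero q] (hq : 288 ≤ q) (χ : DirichletCharacter ℂ q)
    (hχ : χ.Odd) : WeilPositivityOnChar χ 1 := by
  have hq1 : q ≠ 1 := by omega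
  have hS := sum_range_eight_cLow_le
  have hlog := log_floor_bounds.2.1.trans (log_le_log_natCast (by norm_num) hq)
  have hπ := Literature.Analysis.SpecialFunctions.Real.log_pi_le
  refine weilPositivityOnChar_of_budget hq1 χ (charParity_of_odd hχ) one_pos exp_two_le_eight 0
    psi_odd_ge (fun n : ℕ ↦ if n ≤ 2 then (1 : ℝ) else 1 / 2) (cLow_admissible le_rfl 7) ?_
  simp only [Finset.sum_range_zero]
  linarith

/-- **UNIFORM FLOOR AT `t = 1`: every Dirichlet character (any parity, any values, primitive or not) of
every modulus `q ≥ 900` satisfies `WeilPositivityOnChar χ 1`** — Weil positivity on `[-1, 1]` — with no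
`ζ` input and no certificate. [cite: Weil1952FormulesExplicites, (11) and the «lemme» p. 262; Yoshida1992, §6] -/
theorem weilPositivityOnChar_one_of_ge_900 (hq : 900 ≤ q) (χ : DirichletCharacter ℂ q) :
    WeilPositivityOnChar χ 1 := by
  haveI : NeZero q := ⟨by omega⟩
  rcases χ.even_or_odd with h | h
  · exact weilPositivityOnChar_one_of_even_ge_900 hq χ h
  · exact weilPositivityOnChar_one_of_odd_ge_288 (by omega) χ h

/-- … hence every rung `t ≤ 1` for every character of modulus `q ≥ 900`. [folklore] -/
theorem weilPositivityOnChar_of_le_one_of_ge_900 (hq : 900 ≤ q) (χ : DirichletCharacter ℂ q) {t : ℝ}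
    (ht : t ≤ 1) : WeilPositivityOnChar χ t :=
  (weilPositivityOnChar_one_of_ge_900 hq χ).mono ht

/-! ## The `ζ` frontier `4023/5000` -/

/-- **Every EVEN character of modulus `q ≥ 144` satisfies `WeilPositivityOnChar χ (4023/5000)`**
(budget `1.1447299 + 4.22745354 − (4 − 8046/5000) + 2·0.9805768 = 4.9423447 ≤ 4.9698132 ≤ log 144`;
method floor `141`; the tree's `ζ`-transfer floor was `450`, `FrontierTransfer.lean`).
[cite: Weil1952FormulesExplicites, (11) and the «lemme» p. 262; Yoshida1992, §6] -/
theorem weilPositivityOnChar_frontier_of_even_ge_144 (hq : 144 ≤ q) (χ : DirichletCharacter ℂ q)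
    (hχ : χ.Even) : WeilPositivityOnChar χ (4023 / 5000) := by
  have hq1 : q ≠ 1 := by omega
  have hS := sum_range_five_cLow_le
  have hlog := log_floor_bounds.2.2.1.trans (log_le_log_natCast (by norm_num) hq)
  have hπ := Literature.Analysis.SpecialFunctions.Real.log_pi_le
  refine weilPositivityOnChar_of_budget hq1 χ (charParity_of_even hχ) (by norm_num) exp_frontier_le_five 1
    psi_even_ge (fun n : ℕ ↦ if n ≤ 2 then (1 : ℝ) else 1 / 2) (cLow_admissible (by norm_num) 4) ?_
  set S := ∑ n ∈ Finset.range (4 + 1),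
    (Λ n : ℝ) / Real.sqrt n * (fun n : ℕ ↦ if n ≤ 2 then (1 : ℝ) else 1 / 2) n with hSdef
  simp only [Finset.sum_range_one, Nat.cast_zero]
  norm_num
  linarith

/-- **Every ODD character of modulus `q ≥ 72` satisfies `WeilPositivityOnChar χ (4023/5000)`**
(budget `1.1447299 + 1.08586154 + 2·0.9805768 = 4.1917450 ≤ 4.276666 ≤ log 72`; method floor `67`).
[cite: Weil1952FormulesExplicites, (11) and the «lemme» p. 262; Yoshida1992, §6] -/
theorem weilPositivityOnChar_frontier_of_odd_ge_72 [NeZero q] (hq : 72 ≤ q) (χ : DirichletCharacter ℂ q)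
    (hχ : χ.Odd) : WeilPositivityOnChar χ (4023 / 5000) := by
  have hq1 : q ≠ 1 := by omega
  have hS := sum_range_five_cLow_le
  have hlog := log_floor_bounds.2.2.2.1.trans (log_le_log_natCast (by norm_num) hq)
  have hπ := Literature.Analysis.SpecialFunctions.Real.log_pi_le
  refine weilPositivityOnChar_of_budget hq1 χ (charParity_of_odd hχ) (by norm_num) exp_frontier_le_five 0
    psi_odd_ge (fun n : ℕ ↦ if n ≤ 2 then (1 : ℝ) else 1 / 2) (cLow_admissible (by norm_num) 4) ?_
  simp only [Finset.sum_range_zero]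
  linarith

/-- **UNIFORM FLOOR AT THE `ζ` FRONTIER: every Dirichlet character of every modulus `q ≥ 144` satisfies
`WeilPositivityOnChar χ (4023/5000)`** (hence every rung `t ≤ 4023/5000`), with no `ζ` input.
[cite: Weil1952FormulesExplicites, (11) and the «lemme» p. 262; Yoshida1992, §6] -/
theorem weilPositivityOnChar_frontier_of_ge_144 (hq : 144 ≤ q) (χ : DirichletCharacter ℂ q) :
    WeilPositivityOnChar χ (4023 / 5000) := by
  haveI : NeZero q := ⟨by omega⟩
  rcases χ.even_or_odd with h | h
  · exact weilPositivityOnChar_frontier_of_even_ge_144 hq χ h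
  · exact weilPositivityOnChar_frontier_of_odd_ge_72 (by omega) χ h

/-! ## The window `t = log 2`, odd characters -/

/-- **Every ODD character of modulus `q ≥ 30` satisfies `WeilPositivityOnChar χ (log 2)`**
(budget `1.1447299 + 1.08586154 + 2·0.56222 = 3.3550314 ≤ 3.4011973 ≤ log 30`; method floor `29`;
the tree's `ζ`-transfer floor for all characters at `log 2` is `50`, `ThirdPrimeReflectionRungs.lean`).
[cite: Weil1952FormulesExplicites, (11) and the «lemme» p. 262; Yoshida1992, §6] -/
theorem weilPositivityOnChar_log_two_of_odd_ge_30 [NeZero q] (hq : 30 ≤ q) (χ : DirichletCharacter ℂ q)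
    (hχ : χ.Odd) : WeilPositivityOnChar χ (Real.log 2) := by
  have hq1 : q ≠ 1 := by omega
  have hS := sum_range_four_cLogTwo_le
  have hlog := log_floor_bounds.2.2.2.2.trans (log_le_log_natCast (by norm_num) hq)
  have hπ := Literature.Analysis.SpecialFunctions.Real.log_pi_le
  refine weilPositivityOnChar_of_budget hq1 χ (charParity_of_odd hχ) (Real.log_pos (by norm_num))
    exp_two_log_two_le_four 0 psi_odd_ge (fun n : ℕ ↦ if n ≤ 1 then (1 : ℝ) else 1 / 2) (cLogTwo_admissible 3) ?_
  simp only [Finset.sum_range_zero]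
  linarith

end UniformFloor

end Summit.Ventures.WeilGRH

end
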